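import Summits.NavierStokesRegularity.NavierStokesRegularity.Theorems.AxisymmetricExtremalityAxisymmetricKatoGlobalStubSeregin2020TypeIILemma22EnergyClassAcrossAxis
import HarnessLib

/-!
# L22-B, piece F3c: space–time integrability of the energy-class integrands for the NORMALISED pair

Seregin 2020 Lemma 2.2 ⇐ Nazarov–Uraltseva 2012 Lemma 4.2 for the class `𝒱` (cell pub/ns-inputs, kit
`kits/A1-L22B-F3c-trueIntegrands.md`, hand-over ser-b → ns-in-wu-341 g2; consumer: ser-b's F3c assembly
`energyClass_acrossAxis_of_classV`).  The normalised pair of kit A1 item 9 is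
`Φ̃ = Φ` on `{t < 0} ∖ S`, `= k` elsewhere, and `Ũ = U` on `{t < 0} × {ϱ ≠ 0}`, `= 0` elsewhere.
On the whole slab `[t₁,t₂] × ℝ³` the function `Φ̃` is NOT continuous (it jumps across `S`), so the
continuity-based `integrable_sliceIntegrands_acrossAxis` does not apply; but `Φ̃ = Φ` on the open set
`{t<0} ∖ S ⊇ [t₁,t₂] × {ϱ ≠ 0}` (`S ⊆` axis, `t₂ < 0`), the axis is Lebesgue-null, `0 ≤ H(Φ̃) ≤ H(0)`
(`Φ̃ ≥ 0`, `H' ≤ 0`, `H ≥ 0`), `Ũ = U` off the axis and `‖Ũ‖ ≤ ‖U‖` pointwise for `t < 0`.  Hence every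
integrand of the `EnergyClass` text is (bounded measurable factor `H(Φ̃)`) × (an integrand already handled
by the tools of `…Lemma22AcrossAxisTools`), which is what this file proves:

* `integrable_energyClassIntegrands_normalised` — the kit signature verbatim: integrability on
  `vol|_{[t₁,t₂] × ℝ³}` of `η H(Φ̃)|∇Θ|²`, `η H(Φ̃)⟪Ũ, ∇Θ²⟫`, `η (2/ϱ) H(Φ̃) ∂_ϱΘ²`, `|η'| H(Φ̃) Θ²`,
  a.e.-strong measurability of `H(Φ̃)` and a.e.-measurability of the dissipation integrand
  `ofReal (½ η H''(Φ̃) |∇Φ̃|² Θ²)`.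

[cite: NazarovUraltseva2012, §3 (3.9) and §4 Lemma 4.2, (4.3); Seregin2020, Lemma 2.2 (arXiv:2006.04140 p. 8)]

Nothing here is a Navier–Stokes regularity statement.
-/

-- the problem directory repeats the summit name (D-0017); core's `dupNamespace` linter fires
set_option linter.dupNamespace false

noncomputable section

open MeasureTheory Set Function Filter Topology TopologicalSpace Metric WithLp
open scoped NNReal ENNReal InnerProductSpace RealInnerProductSpace

namespace Summit.NavierStokesRegularity.NavierStokesRegularity.Theorems.AxisymmetricKatoGlobal.EulerScaling

open Literature.Analysis.FluidPDE Literature.Analysis.FluidPDE.Seregin2020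

/-- **Space–time integrability of the energy-class integrands for the normalised pair `(Φ̃, Ũ)`**
(module docstring; kit `A1-L22B-F3c-trueIntegrands.md` verbatim).  Data: `U` continuous off the axis on
`{t<0}` with `∬_{Q(a)} |U|³ < ∞` for every parabolic cylinder `Q(a)` at the origin; `S` closed, contained in
`{t ≤ 0} × axis`; `Φ`, `∇Φ` continuous on `{t<0} ∖ S`, `Φ ≥ 0` there; `R, k > 0`; the normalised pair
`Φ' = Φ` on `{t<0} ∖ S` and `= k` elsewhere, `U' = U` on `{t<0} × {ϱ≠0}` and `= 0` elsewhere; `H ∈ C²`,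
`H' ≤ 0`, `H ≥ 0`; `Θ ∈ C¹_c` with `tsupport Θ ⊆ B(0,2R)`; `η ∈ C¹`; `-R² < t₁`, `t₂ < 0`.
[cite: NazarovUraltseva2012, §4 Lemma 4.2, (4.3); Seregin2020, Lemma 2.2] -/
theorem integrable_energyClassIntegrands_normalised
    {U U' : ℝ → EuclideanSpace ℝ (Fin 3) → EuclideanSpace ℝ (Fin 3)} {Φ Φ' : ℝ → EuclideanSpace ℝ (Fin 3) → ℝ}
    {S : Set (ℝ × EuclideanSpace ℝ (Fin 3))} {R k : ℝ}
    (hUc : ContinuousOn (uncurry U) {z : ℝ × EuclideanSpace ℝ (Fin 3) | z.1 < 0 ∧ cylRadius z.2 ≠ 0})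
    (hU3 : ∀ a : ℝ, 0 < a → ∫⁻ z in parabolicCylinder a (0 : ℝ × EuclideanSpace ℝ (Fin 3)), ‖U z.1 z.2‖ₑ ^ (3 : ℕ) < ∞)
    (hSc : IsClosed S) (hSax : ∀ z ∈ S, z.1 ≤ 0 ∧ cylRadius z.2 = 0)
    (hΦc : ContinuousOn (uncurry Φ) ({z : ℝ × EuclideanSpace ℝ (Fin 3) | z.1 < 0} \ S))
    (hΦg : ContinuousOn (fun z : ℝ × EuclideanSpace ℝ (Fin 3) => fderiv ℝ (Φ z.1) z.2)
      ({z : ℝ × EuclideanSpace ℝ (Fin 3) | z.1 < 0} \ S))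
    (hΦ0 : ∀ z : ℝ × EuclideanSpace ℝ (Fin 3), z.1 < 0 → z ∉ S → 0 ≤ Φ z.1 z.2) (hR : 0 < R) (hk : 0 < k)
    (hΦ'1 : ∀ t x, t < 0 → (t, x) ∉ S → Φ' t x = Φ t x) (hΦ'2 : ∀ t x, ¬ (t < 0 ∧ (t, x) ∉ S) → Φ' t x = k)
    (hU'1 : ∀ t x, t < 0 → cylRadius x ≠ 0 → U' t x = U t x) (hU'2 : ∀ t x, ¬ (t < 0 ∧ cylRadius x ≠ 0) → U' t x = 0)
    {H : ℝ → ℝ} (hH : ContDiff ℝ 2 H) (hH' : ∀ v, deriv H v ≤ 0) (hH0 : ∀ v, 0 ≤ H v)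
    {Θ : EuclideanSpace ℝ (Fin 3) → ℝ} (hΘ : ContDiff ℝ 1 Θ) (hΘc : HasCompactSupport Θ)
    (hΘO : tsupport Θ ⊆ ball (0 : EuclideanSpace ℝ (Fin 3)) (2 * R))
    {η : ℝ → ℝ} (hη : ContDiff ℝ 1 η) {t₁ t₂ : ℝ} (ht₁ : -R ^ 2 < t₁) (ht₂ : t₂ < 0) :
    Integrable (fun z : ℝ × EuclideanSpace ℝ (Fin 3) => η z.1 * (H (Φ' z.1 z.2) * ‖gradient Θ z.2‖ ^ 2))
      (volume.restrict (Icc t₁ t₂ ×ˢ (univ : Set (EuclideanSpace ℝ (Fin 3))))) ∧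
    Integrable (fun z : ℝ × EuclideanSpace ℝ (Fin 3) =>
        η z.1 * (H (Φ' z.1 z.2) * inner ℝ (U' z.1 z.2) (gradient (fun y => Θ y ^ 2) z.2)))
      (volume.restrict (Icc t₁ t₂ ×ˢ (univ : Set (EuclideanSpace ℝ (Fin 3))))) ∧
    Integrable (fun z : ℝ × EuclideanSpace ℝ (Fin 3) =>
        η z.1 * (2 / cylRadius z.2 * (H (Φ' z.1 z.2) * fderiv ℝ (fun y => Θ y ^ 2) z.2 (eR z.2))))
      (volume.restrict (Icc t₁ t₂ ×ˢ (univ : Set (EuclideanSpace ℝ (Fin 3))))) ∧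
    Integrable (fun z : ℝ × EuclideanSpace ℝ (Fin 3) => |deriv η z.1| * (H (Φ' z.1 z.2) * Θ z.2 ^ 2))
      (volume.restrict (Icc t₁ t₂ ×ˢ (univ : Set (EuclideanSpace ℝ (Fin 3))))) ∧
    AEStronglyMeasurable (fun z : ℝ × EuclideanSpace ℝ (Fin 3) => H (Φ' z.1 z.2))
      (volume.restrict (Icc t₁ t₂ ×ˢ (univ : Set (EuclideanSpace ℝ (Fin 3))))) ∧
    AEMeasurable (fun z : ℝ × EuclideanSpace ℝ (Fin 3) => ENNReal.ofReal
        (1 / 2 * η z.1 * (deriv (deriv H) (Φ' z.1 z.2) * ‖gradient (Φ' z.1) z.2‖ ^ 2 * Θ z.2 ^ 2)))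
      (volume.restrict (Icc t₁ t₂ ×ˢ (univ : Set (EuclideanSpace ℝ (Fin 3))))) := by
  -- ### the measure and the auxiliary `S`-free slab `]lo, hi[ × B(0, 2R)`
  rw [restrict_Icc_prod_univ_eq_restrict_Ioc_prod]
  set μ : Measure (ℝ × EuclideanSpace ℝ (Fin 3)) := (volume.restrict (Ioc t₁ t₂)).prod volume with hμ
  set K : Set (EuclideanSpace ℝ (Fin 3)) := tsupport Θ with hKdef
  have hK : IsCompact K := hΘc
  set O : Set (EuclideanSpace ℝ (Fin 3)) := ball (0 : EuclideanSpace ℝ (Fin 3)) (2 * R) with hOdef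
  have hO : IsOpen O := isOpen_ball
  have hKO : K ⊆ O := hΘO
  set lo : ℝ := t₁ - R ^ 2 with hlo
  set hi : ℝ := t₂ / 2 with hhi
  have hR2 : 0 < R ^ 2 := by positivity
  have hlo1 : lo < t₁ := by rw [hlo]; linarith
  have hhi2 : t₂ < hi := by rw [hhi]; linarith
  have hhi0 : hi < 0 := by rw [hhi]; linarith
  -- points of the slab off the axis are off `S` and in `{t < 0}`
  have hslab_ax : Ioo lo hi ×ˢ (O ∩ {x : EuclideanSpace ℝ (Fin 3) | cylRadius x ≠ 0}) ⊆
      {z : ℝ × EuclideanSpace ℝ (Fin 3) | z.1 < 0 ∧ cylRadius z.2 ≠ 0} :=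
    fun z hz => ⟨hz.1.2.trans hhi0, hz.2.2⟩
  have hax_S : ∀ z : ℝ × EuclideanSpace ℝ (Fin 3), cylRadius z.2 ≠ 0 → z ∉ S :=
    fun z hz h => hz (hSax z h).2
  have hslab_S : {z : ℝ × EuclideanSpace ℝ (Fin 3) | z.1 < 0 ∧ cylRadius z.2 ≠ 0} ⊆
      {z : ℝ × EuclideanSpace ℝ (Fin 3) | z.1 < 0} \ S :=
    fun z hz => ⟨hz.1, hax_S z hz.2⟩
  -- ### `Φ'` off the axis: continuity, measurability; `0 ≤ H(Φ') ≤ H 0` everywhere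
  have hΦ'c : ContinuousOn (fun z : ℝ × EuclideanSpace ℝ (Fin 3) => Φ' z.1 z.2)
      {z : ℝ × EuclideanSpace ℝ (Fin 3) | z.1 < 0 ∧ cylRadius z.2 ≠ 0} := by
    refine (hΦc.mono hslab_S).congr fun z hz => ?_
    exact hΦ'1 z.1 z.2 hz.1 (hax_S z hz.2)
  have hIcc_ax : Icc t₁ t₂ ×ˢ ((univ : Set (EuclideanSpace ℝ (Fin 3))) ∩ {x | cylRadius x ≠ 0}) ⊆
      {z : ℝ × EuclideanSpace ℝ (Fin 3) | z.1 < 0 ∧ cylRadius z.2 ≠ 0} :=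
    fun z hz => ⟨lt_of_le_of_lt hz.1.2 ht₂, hz.2.2⟩
  have hΦ'm : AEStronglyMeasurable (fun z : ℝ × EuclideanSpace ℝ (Fin 3) => Φ' z.1 z.2) μ := by
    have h := aestronglyMeasurable_restrict_prod_of_continuousOn_offAxis measurableSet_Icc MeasurableSet.univ
      (hΦ'c.mono hIcc_ax)
    rwa [restrict_Icc_prod_univ_eq_restrict_Ioc_prod] at h
  have hHΦ'm : AEStronglyMeasurable (fun z : ℝ × EuclideanSpace ℝ (Fin 3) => H (Φ' z.1 z.2)) μ :=
    hH.continuous.comp_aestronglyMeasurable hΦ'm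
  have hHanti : Antitone H :=
    antitone_of_deriv_nonpos (hH.differentiable (by norm_num)) hH'
  have hΦ'0 : ∀ z : ℝ × EuclideanSpace ℝ (Fin 3), 0 ≤ Φ' z.1 z.2 := by
    intro z
    by_cases h : z.1 < 0 ∧ (z.1, z.2) ∉ S
    · rw [hΦ'1 z.1 z.2 h.1 h.2]; exact hΦ0 z h.1 h.2
    · rw [hΦ'2 z.1 z.2 h]; exact hk.le
  have hHbd : ∀ z : ℝ × EuclideanSpace ℝ (Fin 3), ‖H (Φ' z.1 z.2)‖ ≤ H 0 := by
    intro z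
    rw [Real.norm_of_nonneg (hH0 _)]
    exact hHanti (hΦ'0 z)
  have hHbd' : ∀ᵐ z ∂μ, ‖H (Φ' z.1 z.2)‖ ≤ H 0 := ae_of_all _ hHbd
  -- ### `U'`: continuity off the axis and the `L³` bound on the slab
  have hU'c : ContinuousOn (uncurry U') (Ioo lo hi ×ˢ (O ∩ {x : EuclideanSpace ℝ (Fin 3) | cylRadius x ≠ 0})) := by
    refine (hUc.mono hslab_ax).congr fun z hz => ?_
    exact hU'1 z.1 z.2 (hslab_ax hz).1 (hslab_ax hz).2
  have hU'le : ∀ z : ℝ × EuclideanSpace ℝ (Fin 3), z.1 < 0 → ‖U' z.1 z.2‖ ≤ ‖U z.1 z.2‖ := by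
    intro z hz
    by_cases hρ : cylRadius z.2 ≠ 0
    · rw [hU'1 z.1 z.2 hz hρ]
    · rw [hU'2 z.1 z.2 (fun h => hρ h.2), norm_zero]; exact norm_nonneg _
  have hU'3 : (∫⁻ z in Ioo lo hi ×ˢ O, ‖U' z.1 z.2‖ₑ ^ (3 : ℕ)) < ⊤ := by
    have hsubQ : Ioo lo hi ×ˢ O ⊆ parabolicCylinder (2 * R) (0 : ℝ × EuclideanSpace ℝ (Fin 3)) := by
      intro z hz
      simp only [parabolicCylinder, mem_prod, mem_Ioo, Prod.fst_zero, Prod.snd_zero] at hz ⊢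
      refine ⟨⟨?_, hz.1.2.trans hhi0⟩, hz.2⟩
      have h1 : lo < z.1 := hz.1.1
      rw [hlo] at h1
      nlinarith [h1, ht₁, sq_nonneg R]
    refine lt_of_le_of_lt ?_ (hU3 (2 * R) (by linarith))
    refine (setLIntegral_mono' ?_ fun z hz => ?_).trans (lintegral_mono_set hsubQ)
    · exact measurableSet_Ioo.prod hO.measurableSet
    · have hz0 : z.1 < 0 := hz.1.2.trans hhi0
      have hle := hU'le z hz0
      rw [← ofReal_norm, ← ofReal_norm]
      exact pow_le_pow_left' (ENNReal.ofReal_le_ofReal hle) 3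
  -- ### continuity of the elementary factors
  have hΘ0 : ∀ x, x ∉ K → Θ x = 0 := fun x hx => image_eq_zero_of_notMem_tsupport hx
  have hgΘ0 : ∀ x, x ∉ K → gradient Θ x = 0 := fun x hx => gradient_eq_zero_of_notMem_tsupport hx
  have hgΘ20 : ∀ x, x ∉ K → gradient (fun y => Θ y ^ 2) x = 0 := fun x hx => gradient_sq_eq_zero_of_notMem hx
  have hfΘ20 : ∀ x, x ∉ K → fderiv ℝ (fun y => Θ y ^ 2) x = 0 := fun x hx => fderiv_sq_eq_zero_of_notMem hx
  have hΘ2 : ContDiff ℝ 1 fun y => Θ y ^ 2 := hΘ.pow 2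
  have cη : Continuous fun z : ℝ × EuclideanSpace ℝ (Fin 3) => η z.1 := hη.continuous.comp continuous_fst
  have cη' : Continuous fun z : ℝ × EuclideanSpace ℝ (Fin 3) => |deriv η z.1| :=
    continuous_abs.comp ((hη.continuous_deriv le_rfl).comp continuous_fst)
  have cΘ2 : Continuous fun z : ℝ × EuclideanSpace ℝ (Fin 3) => Θ z.2 ^ 2 := (hΘ.continuous.comp continuous_snd).pow 2
  have cgΘ : Continuous fun z : ℝ × EuclideanSpace ℝ (Fin 3) => ‖gradient Θ z.2‖ ^ 2 :=
    ((continuous_gradient_of_contDiff hΘ).comp continuous_snd).norm.pow 2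
  have cgΘ2 : Continuous fun z : ℝ × EuclideanSpace ℝ (Fin 3) => gradient (fun y => Θ y ^ 2) z.2 :=
    (continuous_gradient_of_contDiff hΘ2).comp continuous_snd
  have cfΘ2 : Continuous fun z : ℝ × EuclideanSpace ℝ (Fin 3) => fderiv ℝ (fun y => Θ y ^ 2) z.2 :=
    (hΘ2.continuous_fderiv one_ne_zero).comp continuous_snd
  have ceR : ContinuousOn (fun z : ℝ × EuclideanSpace ℝ (Fin 3) => eR z.2)
      (Ioo lo hi ×ˢ (O ∩ {x : EuclideanSpace ℝ (Fin 3) | cylRadius x ≠ 0})) :=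
    continuousOn_eR_offAxis.comp continuous_snd.continuousOn fun z hz => hz.2.2
  have cHΦ' : ContinuousOn (fun z : ℝ × EuclideanSpace ℝ (Fin 3) => H (Φ' z.1 z.2))
      (Ioo lo hi ×ˢ (O ∩ {x : EuclideanSpace ℝ (Fin 3) | cylRadius x ≠ 0})) :=
    hH.continuous.comp_continuousOn (hΦ'c.mono hslab_ax)
  refine ⟨?_, ?_, ?_, ?_, hHΦ'm, ?_⟩
  · -- `η H(Φ̃) |∇Θ|² = H(Φ̃) · (η |∇Θ|²)`
    have hg : Integrable (fun z : ℝ × EuclideanSpace ℝ (Fin 3) => η z.1 * ‖gradient Θ z.2‖ ^ 2) μ :=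
      integrable_prod_of_continuousOn_of_eq_zero (W := univ) hK (subset_univ K) hlo1 hhi2
        (cη.mul cgΘ).continuousOn (fun z hz => by simp [hgΘ0 z.2 hz])
    have h := hg.bdd_mul hHΦ'm hHbd'
    refine h.congr (ae_of_all _ fun z => ?_)
    simp only
    ring
  · -- `η H(Φ̃) ⟪Ũ, ∇Θ²⟫ = H(Φ̃) · (η ⟪Ũ, ∇Θ²⟫)`, the drift lemma for `Ũ`
    have hg : Integrable (fun z : ℝ × EuclideanSpace ℝ (Fin 3) =>
        η z.1 * ⟪U' z.1 z.2, gradient (fun y => Θ y ^ 2) z.2⟫) μ :=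
      integrable_prod_driftTerm hO hK hKO hlo1 hhi2 hU'c hU'3 cη.continuousOn cgΘ2.continuousOn
        (fun z hz => hgΘ20 z.2 hz)
    have h := hg.bdd_mul hHΦ'm hHbd'
    refine h.congr (ae_of_all _ fun z => ?_)
    simp only
    ring
  · -- the axis-drift term, `w = η H(Φ̃) ∂_ϱΘ²` continuous off the axis and bounded on `[t₁,t₂] × K`
    obtain ⟨Cη, hCη⟩ := isCompact_Icc.exists_bound_of_continuousOn (s := Icc t₁ t₂) hη.continuous.continuousOn
    obtain ⟨CΘ, hCΘ⟩ := hK.exists_bound_of_continuousOn (s := K) (hΘ2.continuous_fderiv one_ne_zero).continuousOn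
    have hw : ContinuousOn (fun z : ℝ × EuclideanSpace ℝ (Fin 3) =>
        η z.1 * (H (Φ' z.1 z.2) * fderiv ℝ (fun y => Θ y ^ 2) z.2 (eR z.2)))
        (Ioo lo hi ×ˢ (O ∩ {x : EuclideanSpace ℝ (Fin 3) | cylRadius x ≠ 0})) :=
      cη.continuousOn.mul (cHΦ'.mul (cfΘ2.continuousOn.clm_apply ceR))
    have hI := integrable_prod_axisDriftTerm hO hK hKO hlo1 hhi2 hw
      (fun z hz => by simp [hfΘ20 z.2 hz]) (C := Cη * (H 0 * CΘ)) (fun z hz => by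
        rw [abs_mul, abs_mul]
        have h1 : |η z.1| ≤ Cη := by simpa [Real.norm_eq_abs] using hCη z.1 hz.1
        have h2 : |H (Φ' z.1 z.2)| ≤ H 0 := by simpa [Real.norm_eq_abs] using hHbd z
        have h3 : |fderiv ℝ (fun y => Θ y ^ 2) z.2 (eR z.2)| ≤ CΘ := by
          calc |fderiv ℝ (fun y => Θ y ^ 2) z.2 (eR z.2)|
              ≤ ‖fderiv ℝ (fun y => Θ y ^ 2) z.2‖ * ‖eR z.2‖ := by
                rw [← Real.norm_eq_abs]; exact ContinuousLinearMap.le_opNorm _ _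
            _ ≤ CΘ * 1 := mul_le_mul (hCΘ z.2 hz.2) (norm_eR_le_one _) (norm_nonneg _)
                ((norm_nonneg _).trans (hCΘ z.2 hz.2))
            _ = CΘ := mul_one _
        have hCη0 : 0 ≤ Cη := (abs_nonneg _).trans h1
        have hH00 : 0 ≤ H 0 := hH0 0
        exact mul_le_mul h1 (mul_le_mul h2 h3 (abs_nonneg _) hH00) (by positivity) hCη0)
    refine hI.congr (ae_of_all _ fun z => ?_)
    simp only
    ring
  · -- `|η'| H(Φ̃) Θ² = H(Φ̃) · (|η'| Θ²)`
    have hg : Integrable (fun z : ℝ × EuclideanSpace ℝ (Fin 3) => |deriv η z.1| * Θ z.2 ^ 2) μ :=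
      integrable_prod_of_continuousOn_of_eq_zero (W := univ) hK (subset_univ K) hlo1 hhi2
        (cη'.mul cΘ2).continuousOn (fun z hz => by simp [hΘ0 z.2 hz])
    have h := hg.bdd_mul hHΦ'm hHbd'
    refine h.congr (ae_of_all _ fun z => ?_)
    simp only
    ring
  · -- the dissipation integrand: `∇Φ̃ = ∇Φ` a.e. (off the axis, `S` closed), `∇Φ` continuous off `S`
    have hgΦc : ContinuousOn (fun z : ℝ × EuclideanSpace ℝ (Fin 3) => gradient (Φ z.1) z.2)
        {z : ℝ × EuclideanSpace ℝ (Fin 3) | z.1 < 0 ∧ cylRadius z.2 ≠ 0} :=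
      (InnerProductSpace.toDual ℝ (EuclideanSpace ℝ (Fin 3))).symm.continuous.comp_continuousOn
        (hΦg.mono hslab_S)
    have hgΦm : AEStronglyMeasurable (fun z : ℝ × EuclideanSpace ℝ (Fin 3) => gradient (Φ z.1) z.2) μ := by
      have h := aestronglyMeasurable_restrict_prod_of_continuousOn_offAxis measurableSet_Icc MeasurableSet.univ
        (hgΦc.mono hIcc_ax)
      rwa [restrict_Icc_prod_univ_eq_restrict_Ioc_prod] at h
    have hae : ∀ᵐ z ∂μ, gradient (Φ z.1) z.2 = gradient (Φ' z.1) z.2 := by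
      filter_upwards [ae_fst_mem_Ioc t₁ t₂, ae_prod_cylRadius_ne_zero t₁ t₂] with z hz hρ
      have htneg : z.1 < 0 := lt_of_le_of_lt hz.2 ht₂
      have hzS : z ∉ S := hax_S z hρ
      refine Filter.EventuallyEq.gradient_eq ?_
      have hopen : IsOpen {y : EuclideanSpace ℝ (Fin 3) | (z.1, y) ∉ S} :=
        (hSc.preimage (Continuous.prodMk_right z.1)).isOpen_compl
      filter_upwards [hopen.mem_nhds (show z.2 ∈ {y | (z.1, y) ∉ S} from hzS)] with y hy
      exact (hΦ'1 z.1 y htneg hy).symm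
    have hgΦ'm : AEStronglyMeasurable (fun z : ℝ × EuclideanSpace ℝ (Fin 3) => gradient (Φ' z.1) z.2) μ :=
      hgΦm.congr hae
    have hH1 : ContDiff ℝ 1 (deriv H) := by
      have h2' : ContDiff ℝ (1 + 1) H := by rw [one_add_one_eq_two]; exact hH
      exact h2'.deriv'
    have hH''m : AEStronglyMeasurable (fun z : ℝ × EuclideanSpace ℝ (Fin 3) => deriv (deriv H) (Φ' z.1 z.2)) μ :=
      (hH1.continuous_deriv le_rfl).comp_aestronglyMeasurable hΦ'm
    have hprod : AEStronglyMeasurable (fun z : ℝ × EuclideanSpace ℝ (Fin 3) =>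
        1 / 2 * η z.1 * (deriv (deriv H) (Φ' z.1 z.2) * ‖gradient (Φ' z.1) z.2‖ ^ 2 * Θ z.2 ^ 2)) μ :=
      (aestronglyMeasurable_const.mul cη.aestronglyMeasurable).mul
        ((hH''m.mul (hgΦ'm.norm.pow 2)).mul cΘ2.aestronglyMeasurable)
    exact hprod.aemeasurable.ennreal_ofReal

end Summit.NavierStokesRegularity.NavierStokesRegularity.Theorems.AxisymmetricKatoGlobal.EulerScaling

end
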